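import Mathlib
import HarnessLib

/-!
# TwoNotchExactDescent — alternation needs no distortion hypothesis (STAGING; nogo gen 17 rider 6, COLLAPSE-ADDENDUM-4 add-6 §2)

search for candidate a priori estimates; no regularity claim.

The real-inequality core of LEMMA F10♮ (exact descent). In ADD-3 F10 / ADD-4 §Q the spacing descent Δ(φ(o)) < Δ(o) for a
same-chirality occurrence o was obtained with true rates bracketed between k₁ and k₂ times the tan-rates, which imported the
DISTORTION hypothesis c < 1, c_u < 1 (k₂/k₁ < 17 at the canonical sizes) into THEOREM R₂ and everything downstream (add-6 §1, erratum).
With EXACT tangent differences: write μ for the −d main's mid after the first emission (= the absorber's mid after the first kill =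
the far main's mid after its first emission, by level continuity over the empty sub-arcs), m₁ > m₂ = m₁ − t for the mids of the ++ pair,
n₁ > n₂ = n₁ − t for the partner −− pair; then m₂ < m₁ < μ < n₂ < n₁ (m₁ = μ − η₁/2, n₂ = μ + η₁/2), the four rates are
s₁ = T μ − T m₁, c_f = T μ − T m₂, f₁ = T n₁ − T μ, c_s = T n₂ − T μ (T = tan), and the contraction factors are the ratios
ρ_R = s₁/c_f and ρ_L = c_s/f₁ — in (0, 1) by the monotonicity of tan on (−π/2, π/2) alone (`descentR`, `descentL`). F10's four cases
with (ρ_R, ρ_L) in place of the bracketed constant (`caseIa`, `caseIIa`, `caseIb`, `caseIIb`) give Δ′ < Δ: alternation (T1), R₂(i) and —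
one notch down, (d, t) ↦ (t, u) — R₂(ii) hold under (S)(E)(Per) with no distortion hypothesis. `sup_identity` records the closed form of
sup ρ = 1 − sin t/sin d (not needed). The kinematic bookkeeping (which pairs are adjacent on which interval) is prose (add-6 §2, ADD-4 §Q).
Companion files: `NoGo/TwoNotchClockwork.lean` (p266709), `NoGo/TwoNotchClockworkExt` (§D–§E, filing by prove g14).
-/

namespace Summit.NavierStokesRegularity.FunctionalMining.TwoNotchExactDescent



/-- Right descent factor: for `−π/2 < m₂ < m₁ < μ < π/2` the ratio `(tan μ − tan m₁)/(tan μ − tan m₂)` lies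
strictly between `0` and `1` (monotonicity of `tan` on `(−π/2, π/2)`). -/
theorem descentR (μ m₁ m₂ : ℝ) (h₂ : -(Real.pi / 2) < m₂) (h₂₁ : m₂ < m₁) (h₁ : m₁ < μ) (hμ : μ < Real.pi / 2) :
    0 < (Real.tan μ - Real.tan m₁) / (Real.tan μ - Real.tan m₂)
      ∧ (Real.tan μ - Real.tan m₁) / (Real.tan μ - Real.tan m₂) < 1 := by
  have t21 : Real.tan m₂ < Real.tan m₁ :=
    Real.tan_lt_tan_of_lt_of_lt_pi_div_two h₂ (by linarith) h₂₁
  have t1μ : Real.tan m₁ < Real.tan μ :=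
    Real.tan_lt_tan_of_lt_of_lt_pi_div_two (by linarith) hμ h₁
  have hden : 0 < Real.tan μ - Real.tan m₂ := by linarith
  refine ⟨div_pos (by linarith) hden, ?_⟩
  rw [div_lt_one hden]
  linarith

/-- Left descent factor: for `−π/2 < μ < n₂ < n₁ < π/2` the ratio `(tan n₂ − tan μ)/(tan n₁ − tan μ)` lies
strictly between `0` and `1`. -/
theorem descentL (μ n₁ n₂ : ℝ) (hμ : -(Real.pi / 2) < μ) (hμ₂ : μ < n₂) (h₂₁ : n₂ < n₁) (h₁ : n₁ < Real.pi / 2) :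
    0 < (Real.tan n₂ - Real.tan μ) / (Real.tan n₁ - Real.tan μ)
      ∧ (Real.tan n₂ - Real.tan μ) / (Real.tan n₁ - Real.tan μ) < 1 := by
  have tμ2 : Real.tan μ < Real.tan n₂ :=
    Real.tan_lt_tan_of_lt_of_lt_pi_div_two hμ (by linarith) hμ₂
  have t21 : Real.tan n₂ < Real.tan n₁ :=
    Real.tan_lt_tan_of_lt_of_lt_pi_div_two (by linarith) h₁ h₂₁
  have hden : 0 < Real.tan n₁ - Real.tan μ := by linarith
  refine ⟨div_pos (by linarith) hden, ?_⟩
  rw [div_lt_one hden]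
  linarith

/-- Closed form of the supremum of ρ_R = κ₁·cos m₂/cos m₁ (κ₁ = sin(η₁/2)/sin((d+t)/2), attained as the partner goes vertical):
κ₁ (cos t + sin t cot d) = 1 − sin t / sin d, i.e. the product-to-sum identity below; not needed for the descent, recorded. -/
theorem sup_identity (d t : ℝ) :
    2 * Real.sin ((d - t) / 2) * Real.cos ((d + t) / 2) = Real.sin d - Real.sin t := by
  rw [Real.sin_sub_sin]

/-- Case I ∧ α of F10 with exact factors: (I) y_s − y_f ≤ ρ_R Δ, (α) Δ′ ≤ ρ_L (y_s − y_f). -/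
theorem caseIa (Δ Δ' ys yf ρR ρL : ℝ) (hΔ : 0 < Δ) (hR0 : 0 < ρR) (hR1 : ρR < 1) (hL0 : 0 < ρL) (hL1 : ρL < 1)
    (hI : ys - yf ≤ ρR * Δ) (hα : Δ' ≤ ρL * (ys - yf)) : Δ' < Δ := by
  nlinarith [mul_pos hL0 hR0, mul_lt_mul'' hR1 hL1 hR0.le hL0.le]

/-- Case II ∧ α: (II) θ_R = ρ_R (y_f − y₀) with y_s = y₀′ + θ_R, y₀ < y_f < y₀′ = y₀ + Δ; (α) Δ′ ≤ ρ_L (y_s − y_f). -/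
theorem caseIIa (Δ Δ' y0 y0' yf ys θR ρR ρL : ℝ) (hΔ : y0' = y0 + Δ) (h0f : y0 < yf) (hf0' : yf < y0')
    (hR0 : 0 < ρR) (hR1 : ρR < 1) (hL0 : 0 < ρL) (hL1 : ρL < 1)
    (hII : θR = ρR * (yf - y0)) (hs : ys = y0' + θR) (hα : Δ' ≤ ρL * (ys - yf)) : Δ' < Δ := by
  have h1 : ys - yf < Δ := by nlinarith
  have h2 : 0 < ys - yf := by nlinarith
  nlinarith

/-- Case I ∧ β: (I) y_s − y_f ≤ ρ_R Δ; (β) θ_L ρ_L = y_f − y_b with y_b ≤ y_f, Δ′ = y_s − θ_L − y_b. -/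
theorem caseIb (Δ Δ' yb yf ys θL ρR ρL : ℝ) (hΔ : 0 < Δ) (hbf : yb ≤ yf)
    (_hR0 : 0 < ρR) (hR1 : ρR < 1) (hL0 : 0 < ρL) (hL1 : ρL < 1)
    (hI : ys - yf ≤ ρR * Δ) (hβ : θL * ρL = yf - yb) (hΔ' : Δ' = ys - θL - yb) : Δ' < Δ := by
  have hθ : yf - yb ≤ θL := by nlinarith
  nlinarith

/-- Case II ∧ β: (II) θ_R = ρ_R (y_f − y₀), y_s = y₀′ + θ_R, y₀′ = y₀ + Δ, y₀ < y_f; (β) θ_L ρ_L = y_f − y_b, y_b ≤ y_f,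
Δ′ = y_s − θ_L − y_b. -/
theorem caseIIb (Δ Δ' y0 y0' yb yf ys θR θL ρR ρL : ℝ) (hΔ : y0' = y0 + Δ) (h0f : y0 < yf) (hbf : yb ≤ yf)
    (_hR0 : 0 < ρR) (hR1 : ρR < 1) (hL0 : 0 < ρL) (hL1 : ρL < 1)
    (hII : θR = ρR * (yf - y0)) (hs : ys = y0' + θR) (hβ : θL * ρL = yf - yb) (hΔ' : Δ' = ys - θL - yb) :
    Δ' < Δ := by
  have hθ : yf - yb ≤ θL := by nlinarith
  have hθR : θR < yf - y0 := by nlinarith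
  nlinarith

end Summit.NavierStokesRegularity.FunctionalMining.TwoNotchExactDescent
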